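import Summits.BirchSwinnertonDyer.BirchSwinnertonDyer.Theorems.SylvesterTwoHeegnerIndexCoupledDescentL1OfCMFrameClasses
import HarnessLib

/-!
# The COUPLED Cassels–Tate telescope, XXVII: the (T-L1) «Selmer away from `λ` and the places over `m`»
# clauses of RESIDUE c v3 (McCallum Lemma 4.3) for RECIPE-SHAPED CM-frame classes — ANY conductor, ANY level `2^k`

Crux `UpperOffV0HSYPlus` (stmt-BirchSwinnertonDyer-19804), rows' display RESIDUE c v3 (`…TailFourOfResidue` p714972,
l.100–111): for a Kolyvagin prime `ℓ` and `m` with `ℓ ∤ m`, the class `c_X(ℓm)` is Selmer at every place `v` of `K`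
other than `λ = (ℓ)` and the places over the prime factors of `m` (`X ∈ {E_{3p²}, E_p}`, level `2^κ·2^κ`).  This is
the level-`2^k`, conductor-`9·p·n₀` version of the off-level half of #24 `L1_of_cmFrameClasses_four` (p654758-era,
level `2`, conductors `9pℓ`, `9pℓℓ′`), for classes OF RECIPE SHAPE — `c = kolyvaginClass X_K (2^k) hdiv hA (ψ Q) hQ′`
for SOME embedded ring class field `K[9·p·n₀]` with fixing group `N`, a cubic-twist transport `ψ` scaling by
`(v², v³)` with `N v = v`, an admissible `A` and a point `Q ∈ E_9(K̄)^N` (the outputs of SPEC-K-TY §5 (R0)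
`HuShuYin2019.exists_cmFrame_kolyvaginClass` at `M := k`, any conductor).  Discharge = k-ty1's level-generic
one-calls: additive places `v ∣ p`, `v ∣ 3` (`mem_localKers_cubeSumCurve_{three_mul_sq,prime}_of_mem`,
`…_of_three_mem`, p642937 — `B` at `v ∣ 3` uses `p ≡ 4 (9)`), good places `v ∤ 3·p·n₀` (Gross 6.2 (1):
`kolyvaginClass_cmFrame_cubeSumCurve_{three_mul_sq,prime}_mem_selmerLocalKer`, p645361), infinite places
(`mem_selmerLocalKer_infinitePlace_of_isImaginaryQuadratic`); the place `q ∋ r` for a prime `r ∣ n₀` is excluded by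
hypothesis, as in the display.
* `selmerAway_of_recipe_three_mul_sq` / `selmerAway_of_recipe_prime` — per curve, level `n = 2^k` (free `n` + `hn`).
The RESIDUE's binder shape (`∀ ℓ m, Kol ℓ → KolSupp Kol (ℓ*m) → ¬ℓ ∣ m → ∀ v₀ ∋ ℓ, ∀ v ≠ Sum.inr v₀, (∀ q over
m.primeFactors, v ≠ Sum.inr q) → …`) follows by taking `n₀ := ℓ * m` (`(ℓ*m).primeFactors = {ℓ} ∪ m.primeFactors`, and
the place over the inert `ℓ` is unique) once the assembler's `cX` is of recipe shape at conductor `9·p·(ℓ*m)`.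
Theorem-only (no definition, no named fact); nothing asserted on 19804; no stub closed; X12.CMAtTwo NOT proved; BSD not
claimed for any curve.  Sources: McCallum 1991 Lemma 4.3; Gross 1991 Prop. 6.2 (1); HSY 2019 §§1–2; Cox §9.A.
-/

-- every Summits module is named `Summit.<Summit>.<Problem>…`: the duplicated component is by design
set_option linter.dupNamespace false
set_option autoImplicit false

noncomputable section

open scoped Classical
open WeierstrassCurve NumberField IsDedekindDomain Field
open Literature.NumberTheory.EllipticCurves Literature.NumberTheory.GaloisRepresentations
  Literature.NumberTheory.EllipticCurves.HuShuYin2019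

namespace Summit.BirchSwinnertonDyer.BirchSwinnertonDyer.Theorems.SylvesterTwoCoupledTelescope

variable {K : Type} [Field K] [NumberField K]

omit [NumberField K] in
/-- `((a : ℕ) : 𝓞 K) ∉ v` for every `a ∣ n₀` when no prime factor of `n₀` lies in `v` (`n₀ ≠ 0`). [folklore] -/
theorem natCast_not_mem_of_primeFactors {n₀ : ℕ} (hn₀ : n₀ ≠ 0) (v : HeightOneSpectrum (𝓞 K))
    (hv : ∀ r ∈ n₀.primeFactors, ((r : ℕ) : 𝓞 K) ∉ v.asIdeal) : ((n₀ : ℕ) : 𝓞 K) ∉ v.asIdeal := by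
  induction n₀ using Nat.recOnMul with
  | zero => exact absurd rfl hn₀
  | one => intro h; exact v.isPrime.ne_top ((Ideal.eq_top_iff_one _).mpr (by simpa using h))
  | prime q hq => exact hv q (by simp [hq.primeFactors])
  | mul a b iha ihb =>
    have ha : a ≠ 0 := by rintro rfl; exact hn₀ (zero_mul b)
    have hb : b ≠ 0 := by rintro rfl; exact hn₀ (mul_zero a)
    intro h
    push_cast at h
    rcases v.isPrime.mem_or_mem h with h' | h'
    · exact iha ha (fun r hr ↦ hv r (by rw [Nat.primeFactors_mul ha hb]; exact Finset.mem_union_left _ hr)) h'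
    · exact ihb hb (fun r hr ↦ hv r (by rw [Nat.primeFactors_mul ha hb]; exact Finset.mem_union_right _ hr)) h'

/-- ★ **(T-L1) Selmer-away for a recipe-shaped class on `A_K = E_{3p²} ⊗ K`, any conductor `9·p·n₀`, level `2^k`.**
At every place of `K` not over a prime factor of `n₀` the class is Selmer (`p` odd prime, `p ≠ 3`, `K = ℚ(ω)`).
[cite: McCallumLMS1991, §4 Lemma 4.3] [cite: GrossLMS1991, Prop. 6.2 (1)] [cite: HuShuYin2019, §1 p. 4, §2 p. 8] -/
theorem selmerAway_of_recipe_three_mul_sq {ω : K} (hω : ω ^ 2 + ω + 1 = 0) (h2 : Module.finrank ℚ K = 2)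
    {p : ℕ} (hp : p.Prime) (hp2 : p ≠ 2) (hp3 : p ≠ 3) (nl : ℕ) {k : ℕ} (hn : nl = 2 ^ k) {n₀ : ℕ} (hn₀ : n₀ ≠ 0)
    (ιK : K →+* ℂ) (emb : ringClassField K ιK (9 * p * n₀) →+* AlgebraicClosure K)
    (hemb : ∀ x : K, emb (algebraMap K (ringClassField K ιK (9 * p * n₀)) x) = algebraMap K (AlgebraicClosure K) x)
    (N : Subgroup (Field.absoluteGaloisGroup K))
    (hN : ∀ g, g ∈ N ↔ ∀ x : ringClassField K ιK (9 * p * n₀),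
      (show AlgebraicClosure K ≃ₐ[K] AlgebraicClosure K from g) (emb x) = emb x)
    {v9 : AlgebraicClosure K}
    {ψ : geomPoints ((cubeSumCurve 9).baseChange K) ≃+ geomPoints ((cubeSumCurve (3 * (p : ℚ) ^ 2)).baseChange K)}
    (hψ : ∀ {x y : AlgebraicClosure K}
      (h : (((cubeSumCurve 9).baseChange K).baseChange (AlgebraicClosure K)).toAffine.Nonsingular x y),
      ∃ h', ψ (Affine.Point.some x y h) = Affine.Point.some (v9 ^ 2 * x) (v9 ^ 3 * y) h')
    (hNv : ∀ h ∈ N, (show AlgebraicClosure K ≃ₐ[K] AlgebraicClosure K from h) v9 = v9)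
    {A : AddSubgroup (geomPoints ((cubeSumCurve (3 * (p : ℚ) ^ 2)).baseChange K))}
    {hdiv : ∀ P : geomPoints ((cubeSumCurve (3 * (p : ℚ) ^ 2)).baseChange K),
      ∃ R : geomPoints ((cubeSumCurve (3 * (p : ℚ) ^ 2)).baseChange K), ((nl : ℕ) : ℤ) • R = P}
    (hA : KolyvaginCocycle.IsAdmissible (Field.absoluteGaloisGroup K) A ((nl : ℕ) : ℤ))
    {Q : geomPoints ((cubeSumCurve 9).baseChange K)}
    (hQN : Q ∈ FixedPoints.addSubgroup N (geomPoints ((cubeSumCurve 9).baseChange K)))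
    (hQ' : ψ Q ∈ KolyvaginCocycle.invPoints (Field.absoluteGaloisGroup K) A ((nl : ℕ) : ℤ)) :
    ∀ v : Place K, (∀ q : HeightOneSpectrum (𝓞 K), (∃ r ∈ n₀.primeFactors, (r : 𝓞 K) ∈ q.asIdeal) → v ≠ Sum.inr q) →
      kolyvaginClass ((cubeSumCurve (3 * (p : ℚ) ^ 2)).baseChange K) ((nl : ℕ) : ℤ) hdiv hA (ψ Q) hQ' ∈
        selmerLocalKer ((cubeSumCurve (3 * (p : ℚ) ^ 2)).baseChange K) (Place.Completion v) ((nl : ℕ) : ℤ) := by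
  subst hn
  have hK : IsImaginaryQuadratic K := JZero.isImaginaryQuadratic_of_sq_add_self_add_one hω h2
  rintro (x | v) hv
  · exact mem_selmerLocalKer_infinitePlace_of_isImaginaryQuadratic hK _ x _
  · by_cases hpv : ((p : ℕ) : 𝓞 K) ∈ v.asIdeal
    · exact (mem_localKers_cubeSumCurve_three_mul_sq_of_mem hω h2 hp hp2 hp3 v hpv k _).1
    by_cases h3v : ((3 : ℕ) : 𝓞 K) ∈ v.asIdeal
    · exact (mem_localKers_cubeSumCurve_three_mul_sq_of_three_mem hω h2 hp hp3 v h3v k _).1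
    have hn₀v : ((n₀ : ℕ) : 𝓞 K) ∉ v.asIdeal :=
      natCast_not_mem_of_primeFactors hn₀ v fun r hr h ↦ hv v ⟨r, hr, h⟩ rfl
    have h9 : ((9 * p * n₀ : ℕ) : 𝓞 K) ∉ v.asIdeal := by
      intro h
      push_cast at h
      rcases v.isPrime.mem_or_mem h with h' | h'
      · rcases v.isPrime.mem_or_mem h' with h'' | h''
        · exact h3v (by
            have := v.isPrime.mem_of_pow_mem 2 (by simpa [show ((9 : 𝓞 K)) = (3 : 𝓞 K) ^ 2 by norm_num] using h'')
            exact_mod_cast this)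
        · exact hpv (by exact_mod_cast h'')
      · exact hn₀v (by exact_mod_cast h')
    exact kolyvaginClass_cmFrame_cubeSumCurve_three_mul_sq_mem_selmerLocalKer hK ιK
      (mul_ne_zero (mul_ne_zero (by norm_num) hp.ne_zero) hn₀) emb hemb N hN hp
      hp2 hψ hNv hA hQN hQ' v h3v hpv h9

/-- ★ **(T-L1) Selmer-away for a recipe-shaped class on `B_K = E_p ⊗ K`, any conductor `9·p·n₀`, level `2^k`**
(`p ≡ 4 (mod 9)`: the additive place `w ∣ 3` of `E_p` is automatic on this residue class).
[cite: McCallumLMS1991, §4 Lemma 4.3] [cite: GrossLMS1991, Prop. 6.2 (1)] [cite: HuShuYin2019, §1 p. 4, §2 p. 8] -/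
theorem selmerAway_of_recipe_prime {ω : K} (hω : ω ^ 2 + ω + 1 = 0) (h2 : Module.finrank ℚ K = 2)
    {p : ℕ} (hp : p.Prime) (h9p : p % 9 = 4) (nl : ℕ) {k : ℕ} (hn : nl = 2 ^ k) {n₀ : ℕ} (hn₀ : n₀ ≠ 0)
    (ιK : K →+* ℂ) (emb : ringClassField K ιK (9 * p * n₀) →+* AlgebraicClosure K)
    (hemb : ∀ x : K, emb (algebraMap K (ringClassField K ιK (9 * p * n₀)) x) = algebraMap K (AlgebraicClosure K) x)
    (N : Subgroup (Field.absoluteGaloisGroup K))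
    (hN : ∀ g, g ∈ N ↔ ∀ x : ringClassField K ιK (9 * p * n₀),
      (show AlgebraicClosure K ≃ₐ[K] AlgebraicClosure K from g) (emb x) = emb x)
    {v9 : AlgebraicClosure K}
    {ψ : geomPoints ((cubeSumCurve 9).baseChange K) ≃+ geomPoints ((cubeSumCurve (p : ℚ)).baseChange K)}
    (hψ : ∀ {x y : AlgebraicClosure K}
      (h : (((cubeSumCurve 9).baseChange K).baseChange (AlgebraicClosure K)).toAffine.Nonsingular x y),
      ∃ h', ψ (Affine.Point.some x y h) = Affine.Point.some (v9 ^ 2 * x) (v9 ^ 3 * y) h')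
    (hNv : ∀ h ∈ N, (show AlgebraicClosure K ≃ₐ[K] AlgebraicClosure K from h) v9 = v9)
    {A : AddSubgroup (geomPoints ((cubeSumCurve (p : ℚ)).baseChange K))}
    {hdiv : ∀ P : geomPoints ((cubeSumCurve (p : ℚ)).baseChange K),
      ∃ R : geomPoints ((cubeSumCurve (p : ℚ)).baseChange K), ((nl : ℕ) : ℤ) • R = P}
    (hA : KolyvaginCocycle.IsAdmissible (Field.absoluteGaloisGroup K) A ((nl : ℕ) : ℤ))
    {Q : geomPoints ((cubeSumCurve 9).baseChange K)}
    (hQN : Q ∈ FixedPoints.addSubgroup N (geomPoints ((cubeSumCurve 9).baseChange K)))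
    (hQ' : ψ Q ∈ KolyvaginCocycle.invPoints (Field.absoluteGaloisGroup K) A ((nl : ℕ) : ℤ)) :
    ∀ v : Place K, (∀ q : HeightOneSpectrum (𝓞 K), (∃ r ∈ n₀.primeFactors, (r : 𝓞 K) ∈ q.asIdeal) → v ≠ Sum.inr q) →
      kolyvaginClass ((cubeSumCurve (p : ℚ)).baseChange K) ((nl : ℕ) : ℤ) hdiv hA (ψ Q) hQ' ∈
        selmerLocalKer ((cubeSumCurve (p : ℚ)).baseChange K) (Place.Completion v) ((nl : ℕ) : ℤ) := by
  subst hn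
  have hK : IsImaginaryQuadratic K := JZero.isImaginaryQuadratic_of_sq_add_self_add_one hω h2
  have hp2 : p ≠ 2 := by rintro rfl; norm_num at h9p
  have hp3 : p ≠ 3 := by rintro rfl; norm_num at h9p
  rintro (x | v) hv
  · exact mem_selmerLocalKer_infinitePlace_of_isImaginaryQuadratic hK _ x _
  · by_cases hpv : ((p : ℕ) : 𝓞 K) ∈ v.asIdeal
    · exact (mem_localKers_cubeSumCurve_prime_of_mem hω h2 hp hp2 hp3 v hpv k _).1
    by_cases h3v : ((3 : ℕ) : 𝓞 K) ∈ v.asIdeal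
    · exact (mem_localKers_cubeSumCurve_prime_of_three_mem hω h2 hp h9p v h3v k _).1
    have hn₀v : ((n₀ : ℕ) : 𝓞 K) ∉ v.asIdeal :=
      natCast_not_mem_of_primeFactors hn₀ v fun r hr h ↦ hv v ⟨r, hr, h⟩ rfl
    have h9 : ((9 * p * n₀ : ℕ) : 𝓞 K) ∉ v.asIdeal := by
      intro h
      push_cast at h
      rcases v.isPrime.mem_or_mem h with h' | h'
      · rcases v.isPrime.mem_or_mem h' with h'' | h''
        · exact h3v (by
            have := v.isPrime.mem_of_pow_mem 2 (by simpa [show ((9 : 𝓞 K)) = (3 : 𝓞 K) ^ 2 by norm_num] using h'')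
            exact_mod_cast this)
        · exact hpv (by exact_mod_cast h'')
      · exact hn₀v (by exact_mod_cast h')
    exact kolyvaginClass_cmFrame_cubeSumCurve_prime_mem_selmerLocalKer hK ιK
      (mul_ne_zero (mul_ne_zero (by norm_num) hp.ne_zero) hn₀) emb hemb N hN hp
      hp2 hψ hNv hA hQN hQ' v h3v hpv h9

end Summit.BirchSwinnertonDyer.BirchSwinnertonDyer.Theorems.SylvesterTwoCoupledTelescope

end
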